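import Summits.QuantumFields.BalabanUV.T4Continuum.Support.NE3EnergyAssembly

/-!
# T⁴ programme, node NE3, route P2 «ENERGY CONVEXITY» — ROOT T-LIP TYPED AND ASSEMBLED: «Lipschitz response of the
# B11 §E solution in the constraint∕background data» in the ENERGY norm, from the two-data one-path form
# `NE3EnergyPath.twoData_along_path`, kernel-checked over the tree's torus objects

Eleventh generation of the NE3 prover lineage P2 (unit `b2b-balaban-t4-ne3-p2`; ROUND-2 SKELETON-FIRST mandate), the
second root of the skeleton `HOME/t4/skeletons/NE3-t4-ne3-p2.md` (the coordinator's wording for NE3 (U1b): «Lipschitz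
response of the B11 §E fixed point (p.295 (115)–(121), Prop 6) in the coupling/background data»; technique «strict
convexity ⇒ Lipschitz dependence with explicit modulus»).  SETTING.  One background `W` on run A's lattice (unitary,
periodic; in the dictionary `W = cavg L U_B` or any configuration of B11's class (14)); constraint data of run A's
`k`-fold fibre are parametrised WITHOUT a logarithm as `V_B := (avgIter L W k)·exp B` for periodic `𝔲(N)` fields `B` on
the unit lattice (B11 (20) p. 281: the datum enters the chart through `B`; `B = 0` is the fibre of `W` itself).  For two
data `B₁, B₂` and minimisers `U₁, U₂` of the class `𝒞` over the two fibres, the ROOT `EnergyLipschitz` (§1) asks for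
gauges `u_i` and directions `Z_i` with `U_i^{u_i} = W·exp Z_i` and
`energyNorm W (Z₁ − Z₂) ≤ C·‖B₁ − B₂‖_{ℓ²(period)}` — Lipschitz dependence of the constrained minimiser on the
constraint datum in the ENERGY norm, modulus `C` explicit, no contraction, no `a₄`.  §2 `LipLeaves`: the leaves at one
datum pair — B11's translation `A′ = A₁ + H_W B` ((101)–(102) p. 293) makes the tangent space `T` common to both fibres;
the segment `a(t)` in `T` from `A₁(B₁)` to `A₁(B₂)` gives TWO admissible paths `Γ_i(t) = Φ_W(a(t) + H_W B_i)` (one per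
fibre) with the SAME tangent velocity `X = A₁(B₂) − A₁(B₁)`; fields: reps, admissibility of each path in its fibre,
`φ_i = A_{per}(W·exp Γ_i)`, C² data and the Hessian split for `φ₁` (L3–L7 as in `NE3EnergyAssembly.RouteLeaves`), the
derivative `D₂` of `φ₂` at `1`, the MIXED-HESSIAN bound `φ₁′(1) − D₂ ≤ Λ_H·‖B₁ − B₂‖·N(X)` (leaf L11 × L6) and the
end-point closeness `N(Γ₁ 0 − Γ₂ 1) ≤ (1+θ₀)(N(X) + C_H‖B₁ − B₂‖)` (L2 (b) + L11).  §3 **`ne3EnergyLipschitz_of_lipLeaves`**: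
minimality of `U₁` (resp. `U₂`) gives `φ₁(0) ≤ φ₁(t)` (resp. `φ₂(1) ≤ φ₂(t)`) by the gauge invariance of the Wilson action
(`NE3EnergyAssembly.fineAction_gaugeAct`); `twoData_along_path` gives `N(X) ≤ Λ_H‖δB‖/m`, `m ≥ c/2`; hence
`energyNorm W (Z₁ − Z₂) ≤ (1+θ₀)(2Λ_H/c + C_H)·‖B₁ − B₂‖`.  All [folklore]; an IMPLICATION leaves ⇒ root, no leaf proved.

HONEST FRAMING.  Finite-T⁴ bookkeeping (rung (B)+1); NOTHING about Bałaban's minimisers is asserted (the structure is a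
hypothesis SHAPE; the root a `Prop`); no conditional of the cell is used or hidden; NOT infinite volume ∕ mass gap ∕ Clay ∕
summit progress; NE3 NOT proved.  ABSOLUTE RULE kept: no printed sentence is a hypothesis (context: [Balaban1985Variational]
(20) p. 281, (101)–(102) p. 293, §E (115)–(121) + Prop. 6 pp. 295–296, Prop. 9 p. 309 — the printed dependence on the data
is analyticity WITHOUT a modulus).  PLACEMENT: `Summits/QuantumFields/BalabanUV/`; imports `Support.NE3EnergyAssembly` only; moves nothing.
-/

set_option autoImplicit false

open scoped BigOperators Matrix Matrix.Norms.L2Operator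
open NormedSpace Finset

namespace Summit.QuantumFields.BalabanUV.T4Continuum.NE3EnergyLipschitz

open Set
open Literature.MathematicalPhysics.QuantumFieldTheory.Balaban1983to89
open B7Prop1Explicit B7Prop2Explicit MatrixLog UnitaryModel
open T4AveragingDeficitWall hiding Site Plane Plaq Bond
open T4AveragingDeficitWallBoundary (IsPeriodicCfg periodBox)
open AveragingDeficitPeriodicCounting (IsPeriodicDir)
open MinimalActionLevels (perWin levelAction stepWt stepWt_pos)
open MinimalActionSandwich (IsMinimiser admissible)
open NE3EnergyShapes (energyNorm energyNorm_nonneg IsUnitarySite IsPeriodicSite)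
open NE3EnergyPath (twoData_along_path strongConvexity_along_path modulus_ge_half energyResponse_half)
open NE3EnergyAssembly (fineAction_gaugeAct)

noncomputable section

variable {d : ℕ} {n : Type*} [Fintype n] [DecidableEq n]

/-! ## §1 The typed ROOT T-LIP -/

variable (d) in
/-- **ROOT T-LIP — LIPSCHITZ RESPONSE OF THE CONSTRAINED MINIMISER IN THE CONSTRAINT DATUM, ENERGY NORM.**  For the
background `W ∈ domW` and two constraint data `B₁, B₂ ∈ domB` (periodic `𝔲(N)` fields on the unit lattice; the run-A
fibres are those of `V_{B_i} := (avgIter L W k)·exp B_i`), and minimisers `U_i` of the class `𝒞` over the two fibres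
(`IsMinimiser`, p204506): there are periodic `U(N)` gauges `u_i` and periodic `𝔲(N)` directions `Z_i` with
`U_i^{u_i} = W·exp Z_i` and `energyNorm W (Z₁ − Z₂) (period of run A) ≤ C·√(dirSq (B₁ − B₂) (period of the unit lattice))`.
A `Prop`, asserted for no class here.  (Printed context: B11 Prop. 6 ∕ Prop. 9 give existence, uniqueness and
analyticity of the §E solution in its data, without a modulus.) [folklore] -/
@[folklore]
def EnergyLipschitz (𝒞 : ℕ → Set (B7Prop1Explicit.Site d → Fin d → (Matrix n n ℂ)ˣ)) (L N k : ℕ) (C : ℝ)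
    (domW : Set (B7Prop1Explicit.Site d → Fin d → (Matrix n n ℂ)ˣ))
    (domB : Set (B7Prop1Explicit.Site d → Fin d → Matrix n n ℂ)) : Prop :=
  ∀ W ∈ domW, ∀ B₁ ∈ domB, ∀ B₂ ∈ domB, ∀ U₁ U₂ : B7Prop1Explicit.Site d → Fin d → (Matrix n n ℂ)ˣ,
    IsMinimiser d 𝒞 L N k (vary (avgIter L W k) B₁ 1) U₁ → IsMinimiser d 𝒞 L N k (vary (avgIter L W k) B₂ 1) U₂ →
      ∃ (u₁ u₂ : B7Prop1Explicit.Site d → (Matrix n n ℂ)ˣ) (Z₁ Z₂ : B7Prop1Explicit.Site d → Fin d → Matrix n n ℂ),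
        IsUnitarySite u₁ ∧ IsPeriodicSite u₁ ((N * L ^ k : ℕ) : ℤ) ∧ IsUnitarySite u₂ ∧ IsPeriodicSite u₂ ((N * L ^ k : ℕ) : ℤ) ∧
        IsSkewDir Z₁ ∧ IsPeriodicDir Z₁ ((N * L ^ k : ℕ) : ℤ) ∧ IsSkewDir Z₂ ∧ IsPeriodicDir Z₂ ((N * L ^ k : ℕ) : ℤ) ∧
        gaugeAct u₁ U₁ = vary W Z₁ 1 ∧ gaugeAct u₂ U₂ = vary W Z₂ 1 ∧
        energyNorm W (Z₁ - Z₂) (periodBox (N * L ^ k)) ≤ C * Real.sqrt (dirSq (B₁ - B₂) (periodBox N))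

/-! ## §2 The leaves at one datum pair -/

/-- **THE TWO-DATA LEAVES AT ONE PAIR** (background `W`, data `B₁, B₂`, minimisers `U₁, U₂`, level `k`, class `𝒞`),
energy norm `N(·) = energyNorm W · [0, N·L^k)^d`, `δB := √(dirSq (B₁ − B₂) [0,N)^d)`.  DATA: gauges `u₁ u₂`, the common
tangent velocity `X`, the two paths `Γ₁ Γ₂` (one per fibre, same velocity up to the non-tangent corrections), `φ₁` with
`φ₁′ φ₁″`, `φ₂` with its derivative `D₂` at `1`, Hessian forms `Hs`, corrections `uu`, `e`, tangent space `T`, constants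
`(c, Λ, θ, κ, θ₀, ΛH, CH)`.  FIELDS = skeleton leaves L1 (reps, gauges), L2 (adm₁, adm₂, tangent, velocity, close₂),
L3 (act₁, act₂, d1, d2, dφ₂), L4+L6 (symm, split, cont), L5 (coer), L7 (curv), L11 × L6 (mix).  A SHAPE, asserted for no
configuration of Bałaban's. [folklore] -/
@[folklore]
structure LipLeaves (𝒞 : ℕ → Set (B7Prop1Explicit.Site d → Fin d → (Matrix n n ℂ)ˣ)) (L N k : ℕ)
    (W : B7Prop1Explicit.Site d → Fin d → (Matrix n n ℂ)ˣ) (B₁ B₂ : B7Prop1Explicit.Site d → Fin d → Matrix n n ℂ)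
    (U₁ U₂ : B7Prop1Explicit.Site d → Fin d → (Matrix n n ℂ)ˣ)
    (u₁ u₂ : B7Prop1Explicit.Site d → (Matrix n n ℂ)ˣ) (X : B7Prop1Explicit.Site d → Fin d → Matrix n n ℂ)
    (Γ₁ Γ₂ : ℝ → B7Prop1Explicit.Site d → Fin d → Matrix n n ℂ) (φ₁ φ₁' φ₁'' φ₂ : ℝ → ℝ) (D₂ : ℝ)
    (Hs : ℝ → (B7Prop1Explicit.Site d → Fin d → Matrix n n ℂ) →ₗ[ℝ]
      (B7Prop1Explicit.Site d → Fin d → Matrix n n ℂ) →ₗ[ℝ] ℝ)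
    (uu : ℝ → B7Prop1Explicit.Site d → Fin d → Matrix n n ℂ) (e : ℝ → ℝ)
    (T : Set (B7Prop1Explicit.Site d → Fin d → Matrix n n ℂ)) (c Λ θ κ θ₀ ΛH CH : ℝ) : Prop where
  /-- L1: gauges unitary and periodic -/
  gauge : IsUnitarySite u₁ ∧ IsPeriodicSite u₁ ((N * L ^ k : ℕ) : ℤ) ∧ IsUnitarySite u₂ ∧ IsPeriodicSite u₂ ((N * L ^ k : ℕ) : ℤ)
  /-- L1: `U₁^{u₁} = W·exp Γ₁(0)` (the minimiser of fibre 1 at the start of path 1) -/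
  rep₁ : gaugeAct u₁ U₁ = vary W (Γ₁ 0) 1
  /-- L1: `U₂^{u₂} = W·exp Γ₂(1)` (the minimiser of fibre 2 at the end of path 2) -/
  rep₂ : gaugeAct u₂ U₂ = vary W (Γ₂ 1) 1
  /-- L1: end-point directions skew and periodic -/
  dirZ : IsSkewDir (Γ₁ 0) ∧ IsPeriodicDir (Γ₁ 0) ((N * L ^ k : ℕ) : ℤ) ∧
    IsSkewDir (Γ₂ 1) ∧ IsPeriodicDir (Γ₂ 1) ((N * L ^ k : ℕ) : ℤ)
  /-- L2: path 1 stays in fibre 1 (and the class) -/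
  adm₁ : ∀ t ∈ Icc (0:ℝ) 1, vary W (Γ₁ t) 1 ∈ admissible 𝒞 L k (vary (avgIter L W k) B₁ 1)
  /-- L2: path 2 stays in fibre 2 (and the class) -/
  adm₂ : ∀ t ∈ Icc (0:ℝ) 1, vary W (Γ₂ t) 1 ∈ admissible 𝒞 L k (vary (avgIter L W k) B₂ 1)
  /-- L2: the common velocity is tangent -/
  tangent : X ∈ T
  /-- L2 (b): non-tangent velocity correction of path 1 is `θ`-small -/
  velocity : ∀ t ∈ Icc (0:ℝ) 1,
    energyNorm W (uu t) (periodBox (N * L ^ k)) ≤ θ * energyNorm W X (periodBox (N * L ^ k))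
  /-- L2 (b) + L11: the two end points differ by the velocity plus the datum shift, up to `(1+θ₀)` -/
  close₂ : energyNorm W (Γ₁ 0 - Γ₂ 1) (periodBox (N * L ^ k))
    ≤ (1 + θ₀) * (energyNorm W X (periodBox (N * L ^ k)) + CH * Real.sqrt (dirSq (B₁ - B₂) (periodBox N)))
  /-- L3: `φ_i` are the run-A actions along the two paths -/
  act₁ : ∀ t, φ₁ t = fineAction (vary W (Γ₁ t) 1) (perWin d (N * L ^ k))
  act₂ : ∀ t, φ₂ t = fineAction (vary W (Γ₂ t) 1) (perWin d (N * L ^ k))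
  /-- L3: derivatives of `φ₁` on `[0,1]`, derivative of `φ₂` at `1` -/
  d1 : ∀ t ∈ Icc (0:ℝ) 1, HasDerivAt φ₁ (φ₁' t) t
  d2 : ∀ t ∈ Icc (0:ℝ) 1, HasDerivAt φ₁' (φ₁'' t) t
  dφ₂ : HasDerivAt φ₂ D₂ 1
  /-- L4: Hessian split of `φ₁″`, symmetric forms -/
  symm : ∀ t ∈ Icc (0:ℝ) 1, ∀ x y, Hs t x y = Hs t y x
  split : ∀ t ∈ Icc (0:ℝ) 1, φ₁'' t = Hs t (X + uu t) (X + uu t) + e t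
  /-- L5: tangent coercivity -/
  coer : ∀ t ∈ Icc (0:ℝ) 1, ∀ Y ∈ T, c * energyNorm W Y (periodBox (N * L ^ k)) ^ 2 ≤ Hs t Y Y
  /-- L6: continuity -/
  cont : ∀ t ∈ Icc (0:ℝ) 1, ∀ Y Z, |Hs t Y Z|
    ≤ Λ * energyNorm W Y (periodBox (N * L ^ k)) * energyNorm W Z (periodBox (N * L ^ k))
  /-- L7 × L2: curvature term -/
  curv : ∀ t ∈ Icc (0:ℝ) 1, |e t| ≤ κ * energyNorm W X (periodBox (N * L ^ k)) ^ 2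
  /-- L11 × L6 MIX: the first variations of the two fibre-functionals at the common end differ by the datum shift -/
  mix : φ₁' 1 - D₂ ≤ ΛH * Real.sqrt (dirSq (B₁ - B₂) (periodBox N)) * energyNorm W X (periodBox (N * L ^ k))

/-! ## §3 The assembly -/

/-- Minimality along path 1 at `t = 0` (minimiser `U₁` of fibre 1) and along path 2 at `t = 1` (minimiser `U₂` of
fibre 2), by gauge invariance of the Wilson action and the positive level weight. [folklore] -/
theorem LipLeaves.min_along {𝒞 : ℕ → Set (B7Prop1Explicit.Site d → Fin d → (Matrix n n ℂ)ˣ)} {L N k : ℕ} (hL : 1 ≤ L)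
    {W : B7Prop1Explicit.Site d → Fin d → (Matrix n n ℂ)ˣ} {B₁ B₂ : B7Prop1Explicit.Site d → Fin d → Matrix n n ℂ}
    {U₁ U₂ : B7Prop1Explicit.Site d → Fin d → (Matrix n n ℂ)ˣ} {u₁ u₂ : B7Prop1Explicit.Site d → (Matrix n n ℂ)ˣ}
    {X : B7Prop1Explicit.Site d → Fin d → Matrix n n ℂ} {Γ₁ Γ₂ : ℝ → B7Prop1Explicit.Site d → Fin d → Matrix n n ℂ}
    {φ₁ φ₁' φ₁'' φ₂ : ℝ → ℝ} {D₂ : ℝ}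
    {Hs : ℝ → (B7Prop1Explicit.Site d → Fin d → Matrix n n ℂ) →ₗ[ℝ] (B7Prop1Explicit.Site d → Fin d → Matrix n n ℂ) →ₗ[ℝ] ℝ}
    {uu : ℝ → B7Prop1Explicit.Site d → Fin d → Matrix n n ℂ} {e : ℝ → ℝ}
    {T : Set (B7Prop1Explicit.Site d → Fin d → Matrix n n ℂ)} {c Λ θ κ θ₀ ΛH CH : ℝ}
    (h : LipLeaves 𝒞 L N k W B₁ B₂ U₁ U₂ u₁ u₂ X Γ₁ Γ₂ φ₁ φ₁' φ₁'' φ₂ D₂ Hs uu e T c Λ θ κ θ₀ ΛH CH)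
    (h₁ : IsMinimiser d 𝒞 L N k (vary (avgIter L W k) B₁ 1) U₁)
    (h₂ : IsMinimiser d 𝒞 L N k (vary (avgIter L W k) B₂ 1) U₂) :
    (∀ t ∈ Ioo (0:ℝ) 1, φ₁ 0 ≤ φ₁ t) ∧ (∀ t ∈ Ioo (0:ℝ) 1, φ₂ 1 ≤ φ₂ t) := by
  have hc : 0 < ((stepWt d L)⁻¹) ^ k := pow_pos (inv_pos.mpr (stepWt_pos (d := d) L hL)) k
  constructor
  · intro t ht
    have hle := h₁.le _ (h.adm₁ t (Ioo_subset_Icc_self ht))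
    unfold MinimalActionLevels.levelAction at hle
    have hle' := le_of_mul_le_mul_left hle hc
    rw [h.act₁ 0, h.act₁ t, ← h.rep₁, fineAction_gaugeAct]
    exact hle'
  · intro t ht
    have hle := h₂.le _ (h.adm₂ t (Ioo_subset_Icc_self ht))
    unfold MinimalActionLevels.levelAction at hle
    have hle' := le_of_mul_le_mul_left hle hc
    rw [h.act₂ 1, h.act₂ t, ← h.rep₂, fineAction_gaugeAct]
    exact hle'

/-- **LEAVES ⇒ THE TWO-DATA ENERGY BOUND AT ONE PAIR**: under `LipLeaves` with `0 ≤ Λ, θ₀, ΛH`, `0 < c` and the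
budget `2Λθ + Λθ² + κ ≤ c/2`:  `energyNorm W (Γ₁ 0 − Γ₂ 1) ≤ (1+θ₀)·(2ΛH/c + CH)·δB` — `twoData_along_path` BY NAME. [folklore] -/
theorem energyNorm_sub_le_of_lipLeaves {𝒞 : ℕ → Set (B7Prop1Explicit.Site d → Fin d → (Matrix n n ℂ)ˣ)} {L N k : ℕ}
    (hL : 1 ≤ L) {W : B7Prop1Explicit.Site d → Fin d → (Matrix n n ℂ)ˣ} {B₁ B₂ : B7Prop1Explicit.Site d → Fin d → Matrix n n ℂ}
    {U₁ U₂ : B7Prop1Explicit.Site d → Fin d → (Matrix n n ℂ)ˣ} {u₁ u₂ : B7Prop1Explicit.Site d → (Matrix n n ℂ)ˣ}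
    {X : B7Prop1Explicit.Site d → Fin d → Matrix n n ℂ} {Γ₁ Γ₂ : ℝ → B7Prop1Explicit.Site d → Fin d → Matrix n n ℂ}
    {φ₁ φ₁' φ₁'' φ₂ : ℝ → ℝ} {D₂ : ℝ}
    {Hs : ℝ → (B7Prop1Explicit.Site d → Fin d → Matrix n n ℂ) →ₗ[ℝ] (B7Prop1Explicit.Site d → Fin d → Matrix n n ℂ) →ₗ[ℝ] ℝ}
    {uu : ℝ → B7Prop1Explicit.Site d → Fin d → Matrix n n ℂ} {e : ℝ → ℝ}
    {T : Set (B7Prop1Explicit.Site d → Fin d → Matrix n n ℂ)} {c Λ θ κ θ₀ ΛH CH : ℝ}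
    (h : LipLeaves 𝒞 L N k W B₁ B₂ U₁ U₂ u₁ u₂ X Γ₁ Γ₂ φ₁ φ₁' φ₁'' φ₂ D₂ Hs uu e T c Λ θ κ θ₀ ΛH CH)
    (h₁ : IsMinimiser d 𝒞 L N k (vary (avgIter L W k) B₁ 1) U₁)
    (h₂ : IsMinimiser d 𝒞 L N k (vary (avgIter L W k) B₂ 1) U₂)
    (hΛ : 0 ≤ Λ) (hθ₀ : 0 ≤ θ₀) (hΛH : 0 ≤ ΛH) (hc : 0 < c)
    (hbudget : 2 * Λ * θ + Λ * θ ^ 2 + κ ≤ c / 2) :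
    energyNorm W (Γ₁ 0 - Γ₂ 1) (periodBox (N * L ^ k))
      ≤ (1 + θ₀) * (2 * ΛH / c + CH) * Real.sqrt (dirSq (B₁ - B₂) (periodBox N)) := by
  set δB := Real.sqrt (dirSq (B₁ - B₂) (periodBox N)) with hδB
  have hδB0 : 0 ≤ δB := Real.sqrt_nonneg _
  have hm : 0 < c - 2 * Λ * θ - Λ * θ ^ 2 - κ := by linarith
  obtain ⟨hmin₁, hmin₂⟩ := h.min_along hL h₁ h₂
  have hconv := strongConvexity_along_path Hs h.symm (fun Y => energyNorm W Y (periodBox (N * L ^ k)))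
    (fun Y => energyNorm_nonneg _ Y _) T hΛ h.coer h.cont h.tangent uu h.velocity e h.curv h.split
  have hX : energyNorm W X (periodBox (N * L ^ k)) ≤ (ΛH * δB) / (c - 2 * Λ * θ - Λ * θ ^ 2 - κ) :=
    twoData_along_path h.d1 h.d2 hconv hmin₁ h.dφ₂ hmin₂ h.mix hm (energyNorm_nonneg _ _ _) (mul_nonneg hΛH hδB0)
  have hX' : energyNorm W X (periodBox (N * L ^ k)) ≤ 2 * (ΛH * δB) / c :=
    energyResponse_half hc (mul_nonneg hΛH hδB0) (modulus_ge_half hbudget) hX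
  calc energyNorm W (Γ₁ 0 - Γ₂ 1) (periodBox (N * L ^ k))
      ≤ (1 + θ₀) * (energyNorm W X (periodBox (N * L ^ k)) + CH * δB) := h.close₂
    _ ≤ (1 + θ₀) * (2 * (ΛH * δB) / c + CH * δB) := by
        refine mul_le_mul_of_nonneg_left (add_le_add hX' le_rfl) (by linarith)
    _ = (1 + θ₀) * (2 * ΛH / c + CH) * δB := by ring

/-- **LEAVES ⇒ THE TYPED ROOT T-LIP**: uniform leaves over `domW × domB × domB` with constants `(c, Λ, θ, κ, θ₀, ΛH, CH)`
under the budget ⟹ `EnergyLipschitz 𝒞 L N k ((1+θ₀)(2ΛH/c + CH)) domW domB`. [folklore] -/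
theorem ne3EnergyLipschitz_of_lipLeaves {𝒞 : ℕ → Set (B7Prop1Explicit.Site d → Fin d → (Matrix n n ℂ)ˣ)} {L N k : ℕ}
    (hL : 1 ≤ L) {domW : Set (B7Prop1Explicit.Site d → Fin d → (Matrix n n ℂ)ˣ)}
    {domB : Set (B7Prop1Explicit.Site d → Fin d → Matrix n n ℂ)} {c Λ θ κ θ₀ ΛH CH : ℝ}
    (hΛ : 0 ≤ Λ) (hθ₀ : 0 ≤ θ₀) (hΛH : 0 ≤ ΛH) (hc : 0 < c)
    (hbudget : 2 * Λ * θ + Λ * θ ^ 2 + κ ≤ c / 2)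
    (hleaves : ∀ W ∈ domW, ∀ B₁ ∈ domB, ∀ B₂ ∈ domB, ∀ U₁ U₂ : B7Prop1Explicit.Site d → Fin d → (Matrix n n ℂ)ˣ,
      IsMinimiser d 𝒞 L N k (vary (avgIter L W k) B₁ 1) U₁ → IsMinimiser d 𝒞 L N k (vary (avgIter L W k) B₂ 1) U₂ →
        ∃ (u₁ u₂ : B7Prop1Explicit.Site d → (Matrix n n ℂ)ˣ) (X : B7Prop1Explicit.Site d → Fin d → Matrix n n ℂ)
          (Γ₁ Γ₂ : ℝ → B7Prop1Explicit.Site d → Fin d → Matrix n n ℂ) (φ₁ φ₁' φ₁'' φ₂ : ℝ → ℝ) (D₂ : ℝ)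
          (Hs : ℝ → (B7Prop1Explicit.Site d → Fin d → Matrix n n ℂ) →ₗ[ℝ]
            (B7Prop1Explicit.Site d → Fin d → Matrix n n ℂ) →ₗ[ℝ] ℝ)
          (uu : ℝ → B7Prop1Explicit.Site d → Fin d → Matrix n n ℂ) (e : ℝ → ℝ)
          (T : Set (B7Prop1Explicit.Site d → Fin d → Matrix n n ℂ)),
          LipLeaves 𝒞 L N k W B₁ B₂ U₁ U₂ u₁ u₂ X Γ₁ Γ₂ φ₁ φ₁' φ₁'' φ₂ D₂ Hs uu e T c Λ θ κ θ₀ ΛH CH) :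
    EnergyLipschitz d 𝒞 L N k ((1 + θ₀) * (2 * ΛH / c + CH)) domW domB := by
  intro W hW B₁ hB₁ B₂ hB₂ U₁ U₂ hU₁ hU₂
  obtain ⟨u₁, u₂, X, Γ₁, Γ₂, φ₁, φ₁', φ₁'', φ₂, D₂, Hs, uu, e, T, h⟩ := hleaves W hW B₁ hB₁ B₂ hB₂ U₁ U₂ hU₁ hU₂
  exact ⟨u₁, u₂, Γ₁ 0, Γ₂ 1, h.gauge.1, h.gauge.2.1, h.gauge.2.2.1, h.gauge.2.2.2, h.dirZ.1, h.dirZ.2.1, h.dirZ.2.2.1,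
    h.dirZ.2.2.2, h.rep₁, h.rep₂, energyNorm_sub_le_of_lipLeaves hL h hU₁ hU₂ hΛ hθ₀ hΛH hc hbudget⟩

end

end Summit.QuantumFields.BalabanUV.T4Continuum.NE3EnergyLipschitz
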